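import Summits.AtomisticToContinuum.FouriersLaw.Theorems.BondHeatUncertaintySubdiffusiveBondHeatKernelDetailedBalanceLaplaceD
import Summits.AtomisticToContinuum.FouriersLaw.Theorems.BondHeatUncertaintySubdiffusiveBondHeatSmoothDenseL2

/-!
# Kernel detailed balance (H2) of the equilibrium Langevin kernels of the pinned anharmonic chain — the registered stub

Closes the registered stub `stub_kernelDetailedBalance` (H2) of crux `stmt-AtomisticToContinuum-9120`
(`BondHeatUncertainty.SubdiffusiveBondHeat`, line `bath-bond-deficit-integral`):

  `∫ f · (P_s h) dμ_T = ∫ (h∘Θ) · P_s(f∘Θ) dμ_T`   for all measurable `f, h ∈ L²(μ_T)`, `s ≥ 0`,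

i.e. the `L²(μ_T)`-adjoint of `P_s = transitionKernel N T T s` is the momentum-flipped kernel (generalised detailed balance,
Rey-Bellet 2006 Lemma 4.2 at equal temperatures, at the level of the SEMIGROUP). The identity for test functions is
`pinnedChain_detailedBalance_test` (part D); this file extends it to `L²(μ_T)` by density of `C_c^∞` (`stub_smoothDenseL2`) and the
`L²(μ_T)`-contraction of `P_s` for square-integrable observables (`pinnedChain_sq_act_le_of_sq_integrable`, Jensen + invariance).
-/

noncomputable section

open MeasureTheory ProbabilityTheory Filter Topology Set Function
open scoped NNReal ENNReal ContDiff
open Literature.MathematicalPhysics.KineticTheory.HeatConduction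
open Literature.MathematicalPhysics.KineticTheory OscillatorChain
open Summit.AtomisticToContinuum.FouriersLaw.Theorems.OddSectorIrreversibility
open Summit.AtomisticToContinuum.FouriersLaw.Cruxes.SuperadditiveResistance.FloatingProbeBypassLaplacian

namespace Summit.AtomisticToContinuum.FouriersLaw.Theorems.SubdiffusiveBondHeat

variable {N : ℕ}

/-- The product of two square-integrable functions is integrable (`2|ab| ≤ a² + b²`; a.e.-strongly-measurable variant of
`integrable_mul_of_sq`, any measure space). [folklore] -/
theorem integrable_mul_of_sq_aesm {X : Type*} [MeasurableSpace X] {μ : Measure X} {a b : X → ℝ}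
    (ham : AEStronglyMeasurable a μ) (hbm : AEStronglyMeasurable b μ)
    (ha : Integrable (fun z => a z ^ 2) μ) (hb : Integrable (fun z => b z ^ 2) μ) :
    Integrable (fun z => a z * b z) μ := by
  have hs : Integrable (fun z => (a z ^ 2 + b z ^ 2) / 2) μ := (ha.add hb).div_const 2
  refine hs.mono' (ham.mul hbm) (Eventually.of_forall fun z => ?_)
  rw [Real.norm_eq_abs, abs_mul]
  nlinarith [sq_nonneg (|a z| - |b z|), sq_abs (a z), sq_abs (b z)]

section PinnedFinal

variable {ω₂ lam β γ : ℝ} (hω : 0 < ω₂) (hl : 0 < lam) (hβ : 0 < β) (hγ : 0 < γ) (hN : 0 < N)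
  {T : ℝ} (hT : 0 < T)
include hω hl hβ hγ hN hT

/-- **`L²(μ_T)`-contraction of `P_u` on square-integrable observables.** For measurable `g` with `g² ∈ L¹(μ_T)`:
for `μ_T`-a.e. `z`, `g` and `g²` are `P_u(z,·)`-integrable; `(P_u g)² ∈ L¹(μ_T)`; and `∫ (P_u g)² dμ_T ≤ ∫ g² dμ_T`
(Jensen under the Markov kernel and the invariance of `μ_T`). [folklore] -/
theorem pinnedChain_sq_act_le_of_sq_integrable {g : PhaseSpace N → ℝ} (hgm : Measurable g)
    (hg2 : Integrable (fun y => g y ^ 2) ((pinnedChain ω₂ lam β γ).gibbsMeasure N T)) (u : ℝ≥0) :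
    (∀ᵐ z ∂((pinnedChain ω₂ lam β γ).gibbsMeasure N T), Integrable g (((pinnedChain ω₂ lam β γ).transitionKernel N T T u) z) ∧ Integrable (fun y => g y ^ 2) (((pinnedChain ω₂ lam β γ).transitionKernel N T T u) z)) ∧
    Integrable (fun z => (∫ y, g y ∂(((pinnedChain ω₂ lam β γ).transitionKernel N T T u) z)) ^ 2) ((pinnedChain ω₂ lam β γ).gibbsMeasure N T) ∧
    ∫ z, (∫ y, g y ∂(((pinnedChain ω₂ lam β γ).transitionKernel N T T u) z)) ^ 2 ∂((pinnedChain ω₂ lam β γ).gibbsMeasure N T) ≤ ∫ z, g z ^ 2 ∂((pinnedChain ω₂ lam β γ).gibbsMeasure N T) := by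
  haveI : IsProbabilityMeasure ((pinnedChain ω₂ lam β γ).gibbsMeasure N T) := pinnedChain_isProbabilityMeasure_gibbsMeasure hω hl.le hβ.le γ N hT
  haveI : IsMarkovKernel ((pinnedChain ω₂ lam β γ).transitionKernel N T T u) := pinnedChain_isMarkovKernel_transitionKernel hω hl.le hβ.le hγ.le N T T u
  have hinv : ((pinnedChain ω₂ lam β γ).transitionKernel N T T u) ∘ₘ ((pinnedChain ω₂ lam β γ).gibbsMeasure N T) = ((pinnedChain ω₂ lam β γ).gibbsMeasure N T) := pinnedChain_gibbsMeasure_bind_transitionKernel hω hl.le hβ.le hγ.le hN hT u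
  have hg2c : Integrable (fun y => g y ^ 2) (((pinnedChain ω₂ lam β γ).transitionKernel N T T u) ∘ₘ ((pinnedChain ω₂ lam β γ).gibbsMeasure N T)) := by rw [hinv]; exact hg2
  have hcomp := (Measure.integrable_comp_iff hg2c.aestronglyMeasurable).1 hg2c
  have hae2 : ∀ᵐ z ∂((pinnedChain ω₂ lam β γ).gibbsMeasure N T), Integrable (fun y => g y ^ 2) (((pinnedChain ω₂ lam β γ).transitionKernel N T T u) z) := hcomp.1
  have hae1 : ∀ᵐ z ∂((pinnedChain ω₂ lam β γ).gibbsMeasure N T), Integrable g (((pinnedChain ω₂ lam β γ).transitionKernel N T T u) z) := by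
    filter_upwards [hae2] with z hz
    exact ((memLp_two_iff_integrable_sq hgm.aestronglyMeasurable).2 hz).integrable one_le_two
  have hP2int : Integrable (fun z => ∫ y, g y ^ 2 ∂(((pinnedChain ω₂ lam β γ).transitionKernel N T T u) z)) ((pinnedChain ω₂ lam β γ).gibbsMeasure N T) := by
    refine hcomp.2.congr (Eventually.of_forall fun z => ?_)
    refine integral_congr_ae (Eventually.of_forall fun y => ?_)
    simp only [Real.norm_eq_abs, abs_pow, sq_abs]
  have hP2val : ∫ z, (∫ y, g y ^ 2 ∂(((pinnedChain ω₂ lam β γ).transitionKernel N T T u) z)) ∂((pinnedChain ω₂ lam β γ).gibbsMeasure N T) = ∫ z, g z ^ 2 ∂((pinnedChain ω₂ lam β γ).gibbsMeasure N T) :=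
    pinnedChain_integral_transitionKernel_gibbsMeasure hω hl.le hβ.le hγ.le hN hT u hg2
  have hGm : StronglyMeasurable fun z => ∫ y, g y ∂(((pinnedChain ω₂ lam β γ).transitionKernel N T T u) z) := hgm.stronglyMeasurable.integral_kernel (κ := ((pinnedChain ω₂ lam β γ).transitionKernel N T T u))
  have hjensen : ∀ᵐ z ∂((pinnedChain ω₂ lam β γ).gibbsMeasure N T), (∫ y, g y ∂(((pinnedChain ω₂ lam β γ).transitionKernel N T T u) z)) ^ 2 ≤ ∫ y, g y ^ 2 ∂(((pinnedChain ω₂ lam β γ).transitionKernel N T T u) z) := by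
    filter_upwards [hae1, hae2] with z h1 h2
    have hvar : 0 ≤ ∫ y, (g y - ∫ y', g y' ∂(((pinnedChain ω₂ lam β γ).transitionKernel N T T u) z)) ^ 2 ∂(((pinnedChain ω₂ lam β γ).transitionKernel N T T u) z) := integral_nonneg fun y => sq_nonneg _
    have hexp : ∫ y, (g y - ∫ y', g y' ∂(((pinnedChain ω₂ lam β γ).transitionKernel N T T u) z)) ^ 2 ∂(((pinnedChain ω₂ lam β γ).transitionKernel N T T u) z) = (∫ y, g y ^ 2 ∂(((pinnedChain ω₂ lam β γ).transitionKernel N T T u) z)) - (∫ y, g y ∂(((pinnedChain ω₂ lam β γ).transitionKernel N T T u) z)) ^ 2 := by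
      have e : (fun y => (g y - ∫ y', g y' ∂(((pinnedChain ω₂ lam β γ).transitionKernel N T T u) z)) ^ 2) =
          fun y => g y ^ 2 - (2 * ∫ y', g y' ∂(((pinnedChain ω₂ lam β γ).transitionKernel N T T u) z)) * g y + (∫ y', g y' ∂(((pinnedChain ω₂ lam β γ).transitionKernel N T T u) z)) ^ 2 := by
        funext y; ring
      have i1 : Integrable (fun y => g y ^ 2 - (2 * ∫ y', g y' ∂(((pinnedChain ω₂ lam β γ).transitionKernel N T T u) z)) * g y) (((pinnedChain ω₂ lam β γ).transitionKernel N T T u) z) := h2.sub (h1.const_mul _)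
      rw [e, integral_add i1 (integrable_const _), integral_sub h2 (h1.const_mul _), integral_const_mul, integral_const]
      simp only [probReal_univ, smul_eq_mul, one_mul]
      ring
    linarith
  have hG2int : Integrable (fun z => (∫ y, g y ∂(((pinnedChain ω₂ lam β γ).transitionKernel N T T u) z)) ^ 2) ((pinnedChain ω₂ lam β γ).gibbsMeasure N T) :=
    hP2int.mono' (hGm.measurable.pow_const 2).aestronglyMeasurable (by
      filter_upwards [hjensen] with z hz
      rw [Real.norm_eq_abs, abs_of_nonneg (sq_nonneg _)]; exact hz)
  refine ⟨?_, hG2int, ?_⟩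
  · filter_upwards [hae1, hae2] with z h1 h2
    exact ⟨h1, h2⟩
  · rw [← hP2val]
    exact integral_mono_ae hG2int hP2int hjensen

/-- **Weighted bound on the change of a correlation** under a change of BOTH observables in `L²(μ_T)`: for measurable
square-integrable `a₁, a₂, b₁, b₂`, `u ≥ 0` and `t, r > 0`,
`|⟨a₁, P_u b₁⟩ - ⟨a₂, P_u b₂⟩| ≤ (t ∫(a₁-a₂)² + t⁻¹ ∫ b₁²)/2 + (r ∫ a₂² + r⁻¹ ∫ (b₁-b₂)²)/2`. [folklore] -/
theorem pinnedChain_corr_sub_corr_le {a₁ a₂ b₁ b₂ : PhaseSpace N → ℝ} (ha₁ : Measurable a₁) (ha₂ : Measurable a₂)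
    (hb₁ : Measurable b₁) (hb₂ : Measurable b₂)
    (ha₁2 : Integrable (fun y => a₁ y ^ 2) ((pinnedChain ω₂ lam β γ).gibbsMeasure N T)) (ha₂2 : Integrable (fun y => a₂ y ^ 2) ((pinnedChain ω₂ lam β γ).gibbsMeasure N T))
    (hb₁2 : Integrable (fun y => b₁ y ^ 2) ((pinnedChain ω₂ lam β γ).gibbsMeasure N T)) (hb₂2 : Integrable (fun y => b₂ y ^ 2) ((pinnedChain ω₂ lam β γ).gibbsMeasure N T))
    (u : ℝ≥0) {t r : ℝ} (ht : 0 < t) (hr : 0 < r) :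
    |(∫ z, a₁ z * (∫ y, b₁ y ∂(((pinnedChain ω₂ lam β γ).transitionKernel N T T u) z)) ∂((pinnedChain ω₂ lam β γ).gibbsMeasure N T)) - ∫ z, a₂ z * (∫ y, b₂ y ∂(((pinnedChain ω₂ lam β γ).transitionKernel N T T u) z)) ∂((pinnedChain ω₂ lam β γ).gibbsMeasure N T)|
      ≤ (t * ∫ z, (a₁ z - a₂ z) ^ 2 ∂((pinnedChain ω₂ lam β γ).gibbsMeasure N T) + t⁻¹ * ∫ z, b₁ z ^ 2 ∂((pinnedChain ω₂ lam β γ).gibbsMeasure N T)) / 2 +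
        (r * ∫ z, a₂ z ^ 2 ∂((pinnedChain ω₂ lam β γ).gibbsMeasure N T) + r⁻¹ * ∫ z, (b₁ z - b₂ z) ^ 2 ∂((pinnedChain ω₂ lam β γ).gibbsMeasure N T)) / 2 := by
  haveI : IsProbabilityMeasure ((pinnedChain ω₂ lam β γ).gibbsMeasure N T) := pinnedChain_isProbabilityMeasure_gibbsMeasure hω hl.le hβ.le γ N hT
  -- differences are square integrable
  have hsq_sub : ∀ {p q : PhaseSpace N → ℝ}, Measurable p → Measurable q → Integrable (fun y => p y ^ 2) ((pinnedChain ω₂ lam β γ).gibbsMeasure N T) →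
      Integrable (fun y => q y ^ 2) ((pinnedChain ω₂ lam β γ).gibbsMeasure N T) → Integrable (fun y => (p y - q y) ^ 2) ((pinnedChain ω₂ lam β γ).gibbsMeasure N T) := by
    intro p q hp hq hp2 hq2
    have hpL : MemLp p 2 ((pinnedChain ω₂ lam β γ).gibbsMeasure N T) := (memLp_two_iff_integrable_sq hp.aestronglyMeasurable).2 hp2
    have hqL : MemLp q 2 ((pinnedChain ω₂ lam β γ).gibbsMeasure N T) := (memLp_two_iff_integrable_sq hq.aestronglyMeasurable).2 hq2
    exact (memLp_two_iff_integrable_sq (hp.fun_sub hq).aestronglyMeasurable).1 (hpL.sub hqL)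
  have hda := hsq_sub ha₁ ha₂ ha₁2 ha₂2
  have hdb := hsq_sub hb₁ hb₂ hb₁2 hb₂2
  -- contraction facts
  obtain ⟨hae_b₁, hG₁2, hG₁le⟩ := pinnedChain_sq_act_le_of_sq_integrable hω hl hβ hγ hN hT hb₁ hb₁2 u
  obtain ⟨hae_b₂, hG₂2, -⟩ := pinnedChain_sq_act_le_of_sq_integrable hω hl hβ hγ hN hT hb₂ hb₂2 u
  obtain ⟨-, hGd2, hGdle⟩ := pinnedChain_sq_act_le_of_sq_integrable hω hl hβ hγ hN hT (hb₁.fun_sub hb₂) hdb u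
  have hG₁m : AEStronglyMeasurable (fun z => ∫ y, b₁ y ∂(((pinnedChain ω₂ lam β γ).transitionKernel N T T u) z)) ((pinnedChain ω₂ lam β γ).gibbsMeasure N T) :=
    (hb₁.stronglyMeasurable.integral_kernel (κ := ((pinnedChain ω₂ lam β γ).transitionKernel N T T u))).aestronglyMeasurable
  have hG₂m : AEStronglyMeasurable (fun z => ∫ y, b₂ y ∂(((pinnedChain ω₂ lam β γ).transitionKernel N T T u) z)) ((pinnedChain ω₂ lam β γ).gibbsMeasure N T) :=
    (hb₂.stronglyMeasurable.integral_kernel (κ := ((pinnedChain ω₂ lam β γ).transitionKernel N T T u))).aestronglyMeasurable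
  -- `P_u b₁ - P_u b₂ = P_u (b₁ - b₂)` a.e.
  have hGsub : (fun z => (∫ y, b₁ y ∂(((pinnedChain ω₂ lam β γ).transitionKernel N T T u) z)) - ∫ y, b₂ y ∂(((pinnedChain ω₂ lam β γ).transitionKernel N T T u) z)) =ᵐ[((pinnedChain ω₂ lam β γ).gibbsMeasure N T)] fun z => ∫ y, (b₁ y - b₂ y) ∂(((pinnedChain ω₂ lam β γ).transitionKernel N T T u) z) := by
    filter_upwards [hae_b₁, hae_b₂] with z h1 h2
    rw [integral_sub h1.1 h2.1]
  -- split the difference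
  have i11 : Integrable (fun z => a₁ z * ∫ y, b₁ y ∂(((pinnedChain ω₂ lam β γ).transitionKernel N T T u) z)) ((pinnedChain ω₂ lam β γ).gibbsMeasure N T) := integrable_mul_of_sq_aesm ha₁.aestronglyMeasurable hG₁m ha₁2 hG₁2
  have i21 : Integrable (fun z => a₂ z * ∫ y, b₁ y ∂(((pinnedChain ω₂ lam β γ).transitionKernel N T T u) z)) ((pinnedChain ω₂ lam β γ).gibbsMeasure N T) := integrable_mul_of_sq_aesm ha₂.aestronglyMeasurable hG₁m ha₂2 hG₁2
  have i22 : Integrable (fun z => a₂ z * ∫ y, b₂ y ∂(((pinnedChain ω₂ lam β γ).transitionKernel N T T u) z)) ((pinnedChain ω₂ lam β γ).gibbsMeasure N T) := integrable_mul_of_sq_aesm ha₂.aestronglyMeasurable hG₂m ha₂2 hG₂2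
  have s1 : ∫ z, (a₁ z - a₂ z) * (∫ y, b₁ y ∂(((pinnedChain ω₂ lam β γ).transitionKernel N T T u) z)) ∂((pinnedChain ω₂ lam β γ).gibbsMeasure N T) =
      (∫ z, a₁ z * (∫ y, b₁ y ∂(((pinnedChain ω₂ lam β γ).transitionKernel N T T u) z)) ∂((pinnedChain ω₂ lam β γ).gibbsMeasure N T)) - ∫ z, a₂ z * (∫ y, b₁ y ∂(((pinnedChain ω₂ lam β γ).transitionKernel N T T u) z)) ∂((pinnedChain ω₂ lam β γ).gibbsMeasure N T) := by
    rw [← integral_sub i11 i21]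
    refine integral_congr_ae (Eventually.of_forall fun z => ?_)
    beta_reduce
    ring
  have s2 : ∫ z, a₂ z * (∫ y, (b₁ y - b₂ y) ∂(((pinnedChain ω₂ lam β γ).transitionKernel N T T u) z)) ∂((pinnedChain ω₂ lam β γ).gibbsMeasure N T) =
      (∫ z, a₂ z * (∫ y, b₁ y ∂(((pinnedChain ω₂ lam β γ).transitionKernel N T T u) z)) ∂((pinnedChain ω₂ lam β γ).gibbsMeasure N T)) - ∫ z, a₂ z * (∫ y, b₂ y ∂(((pinnedChain ω₂ lam β γ).transitionKernel N T T u) z)) ∂((pinnedChain ω₂ lam β γ).gibbsMeasure N T) := by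
    rw [← integral_sub i21 i22]
    refine integral_congr_ae ?_
    filter_upwards [hGsub] with z hz
    rw [← hz]
    ring
  have b1 := abs_integral_mul_le_weighted hda hG₁2 ht
  have b2 := abs_integral_mul_le_weighted ha₂2 hGd2 hr
  beta_reduce at b1 b2
  have hti : 0 ≤ t⁻¹ := inv_nonneg.2 ht.le
  have hri : 0 ≤ r⁻¹ := inv_nonneg.2 hr.le
  have m1 := mul_le_mul_of_nonneg_left hG₁le hti
  have m2 := mul_le_mul_of_nonneg_left hGdle hri
  have e1 : (∫ z, a₁ z * (∫ y, b₁ y ∂(((pinnedChain ω₂ lam β γ).transitionKernel N T T u) z)) ∂((pinnedChain ω₂ lam β γ).gibbsMeasure N T)) - ∫ z, a₂ z * (∫ y, b₂ y ∂(((pinnedChain ω₂ lam β γ).transitionKernel N T T u) z)) ∂((pinnedChain ω₂ lam β γ).gibbsMeasure N T) =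
      (∫ z, (a₁ z - a₂ z) * (∫ y, b₁ y ∂(((pinnedChain ω₂ lam β γ).transitionKernel N T T u) z)) ∂((pinnedChain ω₂ lam β γ).gibbsMeasure N T)) + ∫ z, a₂ z * (∫ y, (b₁ y - b₂ y) ∂(((pinnedChain ω₂ lam β γ).transitionKernel N T T u) z)) ∂((pinnedChain ω₂ lam β γ).gibbsMeasure N T) := by
    rw [s1, s2]; ring
  rw [e1]
  refine (abs_add_le _ _).trans (add_le_add (b1.trans ?_) (b2.trans ?_))
  · linarith
  · linarith

/-- **Kernel detailed balance (H2) for square-integrable observables.** For the pinned chain (`ω₂, lam, β, γ, T > 0`,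
`N ≥ 1`), every `u ≥ 0` and measurable `f, h` with `f², h² ∈ L¹(μ_T)`:
`∫ f · P_u h dμ_T = ∫ (h∘Θ) · P_u (f∘Θ) dμ_T`. Density of `C_c^∞` in `L²(μ_T)` (`stub_smoothDenseL2`) and the two-slot
bound `pinnedChain_corr_sub_corr_le` reduce it to test functions (`pinnedChain_detailedBalance_test`).
[cite: ReyBellet2006, Lemma 4.2] -/
theorem pinnedChain_detailedBalance {f h : PhaseSpace N → ℝ} (hfm : Measurable f) (hhm : Measurable h)
    (hf2 : Integrable (fun y => f y ^ 2) ((pinnedChain ω₂ lam β γ).gibbsMeasure N T)) (hh2 : Integrable (fun y => h y ^ 2) ((pinnedChain ω₂ lam β γ).gibbsMeasure N T)) (u : ℝ≥0) :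
    ∫ z, f z * (∫ y, h y ∂(((pinnedChain ω₂ lam β γ).transitionKernel N T T u) z)) ∂((pinnedChain ω₂ lam β γ).gibbsMeasure N T) = ∫ z, h (z.1, -z.2) * (∫ y, f (y.1, -y.2) ∂(((pinnedChain ω₂ lam β γ).transitionKernel N T T u) z)) ∂((pinnedChain ω₂ lam β γ).gibbsMeasure N T) := by
  haveI : IsProbabilityMeasure ((pinnedChain ω₂ lam β γ).gibbsMeasure N T) := pinnedChain_isProbabilityMeasure_gibbsMeasure hω hl.le hβ.le γ N hT
  -- flipped data
  have hfΘm : Measurable fun z : PhaseSpace N => f (z.1, -z.2) := hfm.comp (measurable_fst.prodMk measurable_snd.neg)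
  have hhΘm : Measurable fun z : PhaseSpace N => h (z.1, -z.2) := hhm.comp (measurable_fst.prodMk measurable_snd.neg)
  have hflip_sq : ∀ (F : PhaseSpace N → ℝ), Integrable (fun y => F y ^ 2) ((pinnedChain ω₂ lam β γ).gibbsMeasure N T) →
      Integrable (fun y : PhaseSpace N => F (y.1, -y.2) ^ 2) ((pinnedChain ω₂ lam β γ).gibbsMeasure N T) := fun F hF =>
    integrable_flip_gibbsMeasure (pinnedChain ω₂ lam β γ) N T (F := fun y => F y ^ 2) hF
  have hfΘ2 := hflip_sq f hf2
  have hhΘ2 := hflip_sq h hh2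
  have hF₂0 : 0 ≤ ∫ z, f z ^ 2 ∂((pinnedChain ω₂ lam β γ).gibbsMeasure N T) := integral_nonneg fun z => sq_nonneg _
  have hH₂0 : 0 ≤ ∫ z, h z ^ 2 ∂((pinnedChain ω₂ lam β γ).gibbsMeasure N T) := integral_nonneg fun z => sq_nonneg _
  have hfL : MemLp f 2 ((pinnedChain ω₂ lam β γ).gibbsMeasure N T) := (memLp_two_iff_integrable_sq hfm.aestronglyMeasurable).2 hf2
  have hhL : MemLp h 2 ((pinnedChain ω₂ lam β γ).gibbsMeasure N T) := (memLp_two_iff_integrable_sq hhm.aestronglyMeasurable).2 hh2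
  -- the key estimate
  have key : ∀ ε : ℝ, 0 < ε → ε ≤ 1 →
      |(∫ z, f z * (∫ y, h y ∂(((pinnedChain ω₂ lam β γ).transitionKernel N T T u) z)) ∂((pinnedChain ω₂ lam β γ).gibbsMeasure N T)) - ∫ z, h (z.1, -z.2) * (∫ y, f (y.1, -y.2) ∂(((pinnedChain ω₂ lam β γ).transitionKernel N T T u) z)) ∂((pinnedChain ω₂ lam β γ).gibbsMeasure N T)| ≤
        (4 + 3 * (∫ z, f z ^ 2 ∂((pinnedChain ω₂ lam β γ).gibbsMeasure N T)) + 3 * ∫ z, h z ^ 2 ∂((pinnedChain ω₂ lam β γ).gibbsMeasure N T)) * ε := by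
    intro ε hε hε1
    have hδ0 : 0 < ε ^ 2 := by positivity
    obtain ⟨φ, hφ, hφc, hφδ⟩ := stub_smoothDenseL2 N ((pinnedChain ω₂ lam β γ).gibbsMeasure N T) f hfL (ε ^ 2) hδ0
    obtain ⟨ψ, hψ, hψc, hψδ⟩ := stub_smoothDenseL2 N ((pinnedChain ω₂ lam β γ).gibbsMeasure N T) h hhL (ε ^ 2) hδ0
    obtain ⟨Bφ, hBφ⟩ := hφ.continuous.bounded_above_of_compact_support hφc
    obtain ⟨Bψ, hBψ⟩ := hψ.continuous.bounded_above_of_compact_support hψc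
    have hφm : Measurable φ := hφ.continuous.measurable
    have hψm : Measurable ψ := hψ.continuous.measurable
    have hφ2 : Integrable (fun y => φ y ^ 2) ((pinnedChain ω₂ lam β γ).gibbsMeasure N T) := pinnedChain_integrable_sq_of_bounded hω hl.le hT hφ.continuous hBφ hβ.le
    have hψ2 : Integrable (fun y => ψ y ^ 2) ((pinnedChain ω₂ lam β γ).gibbsMeasure N T) := pinnedChain_integrable_sq_of_bounded hω hl.le hT hψ.continuous hBψ hβ.le
    have hφΘm : Measurable fun z : PhaseSpace N => φ (z.1, -z.2) := hφm.comp (measurable_fst.prodMk measurable_snd.neg)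
    have hψΘm : Measurable fun z : PhaseSpace N => ψ (z.1, -z.2) := hψm.comp (measurable_fst.prodMk measurable_snd.neg)
    have hφΘ2 := hflip_sq φ hφ2
    have hψΘ2 := hflip_sq ψ hψ2
    -- (H2) for the test functions
    have htest := pinnedChain_detailedBalance_test hω hl hβ hγ hN hT hφ hφc hψ hψc u
    -- the two approximation errors
    have hεi : 0 < ε⁻¹ := inv_pos.2 hε
    have E1 := pinnedChain_corr_sub_corr_le hω hl hβ hγ hN hT hfm hφm hhm hψm hf2 hφ2 hh2 hψ2 u hεi hε
    have E2 := pinnedChain_corr_sub_corr_le hω hl hβ hγ hN hT hhΘm hψΘm hfΘm hφΘm hhΘ2 hψΘ2 hfΘ2 hφΘ2 u hεi hε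
    beta_reduce at E1 E2
    rw [inv_inv] at E1 E2
    -- the `L²` distances and squares, with flips removed
    have d3 : ∫ z, (h (z.1, -z.2) - ψ (z.1, -z.2)) ^ 2 ∂((pinnedChain ω₂ lam β γ).gibbsMeasure N T) ≤ ε ^ 2 := by
      rw [integral_flip_gibbsMeasure (pinnedChain ω₂ lam β γ) N T (fun w => (h w - ψ w) ^ 2)]; exact hψδ
    have d4 : ∫ z, (f (z.1, -z.2) - φ (z.1, -z.2)) ^ 2 ∂((pinnedChain ω₂ lam β γ).gibbsMeasure N T) ≤ ε ^ 2 := by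
      rw [integral_flip_gibbsMeasure (pinnedChain ω₂ lam β γ) N T (fun w => (f w - φ w) ^ 2)]; exact hφδ
    have q1 : ∫ z, f (z.1, -z.2) ^ 2 ∂((pinnedChain ω₂ lam β γ).gibbsMeasure N T) = ∫ z, f z ^ 2 ∂((pinnedChain ω₂ lam β γ).gibbsMeasure N T) := integral_flip_gibbsMeasure (pinnedChain ω₂ lam β γ) N T (fun w => f w ^ 2)
    have hsq_aux : ∀ {p q : PhaseSpace N → ℝ}, Measurable p → Measurable q → MemLp p 2 ((pinnedChain ω₂ lam β γ).gibbsMeasure N T) →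
        Integrable (fun y => q y ^ 2) ((pinnedChain ω₂ lam β γ).gibbsMeasure N T) → Integrable (fun y => (p y - q y) ^ 2) ((pinnedChain ω₂ lam β γ).gibbsMeasure N T) := by
      intro p q hp hq hpL hq2
      have hqL : MemLp q 2 ((pinnedChain ω₂ lam β γ).gibbsMeasure N T) := (memLp_two_iff_integrable_sq hq.aestronglyMeasurable).2 hq2
      exact (memLp_two_iff_integrable_sq (hp.fun_sub hq).aestronglyMeasurable).1 (hpL.sub hqL)
    have hφsq : ∫ z, φ z ^ 2 ∂((pinnedChain ω₂ lam β γ).gibbsMeasure N T) ≤ 2 * (∫ z, f z ^ 2 ∂((pinnedChain ω₂ lam β γ).gibbsMeasure N T)) + 2 * ε ^ 2 := by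
      have i1 : Integrable (fun z => 2 * f z ^ 2) ((pinnedChain ω₂ lam β γ).gibbsMeasure N T) := hf2.const_mul 2
      have i2 : Integrable (fun z => 2 * (f z - φ z) ^ 2) ((pinnedChain ω₂ lam β γ).gibbsMeasure N T) := (hsq_aux hfm hφm hfL hφ2).const_mul 2
      have isum : Integrable (fun z => 2 * f z ^ 2 + 2 * (f z - φ z) ^ 2) ((pinnedChain ω₂ lam β γ).gibbsMeasure N T) := i1.add i2
      have h1 := integral_mono hφ2 isum fun z => (by nlinarith [sq_nonneg (2 * f z - φ z)] :
        φ z ^ 2 ≤ 2 * f z ^ 2 + 2 * (f z - φ z) ^ 2)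
      rw [integral_add i1 i2, integral_const_mul, integral_const_mul] at h1
      linarith
    have hψsq : ∫ z, ψ (z.1, -z.2) ^ 2 ∂((pinnedChain ω₂ lam β γ).gibbsMeasure N T) ≤ 2 * (∫ z, h z ^ 2 ∂((pinnedChain ω₂ lam β γ).gibbsMeasure N T)) + 2 * ε ^ 2 := by
      rw [integral_flip_gibbsMeasure (pinnedChain ω₂ lam β γ) N T (fun w => ψ w ^ 2)]
      have i1 : Integrable (fun z => 2 * h z ^ 2) ((pinnedChain ω₂ lam β γ).gibbsMeasure N T) := hh2.const_mul 2
      have i2 : Integrable (fun z => 2 * (h z - ψ z) ^ 2) ((pinnedChain ω₂ lam β γ).gibbsMeasure N T) := (hsq_aux hhm hψm hhL hψ2).const_mul 2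
      have isum : Integrable (fun z => 2 * h z ^ 2 + 2 * (h z - ψ z) ^ 2) ((pinnedChain ω₂ lam β γ).gibbsMeasure N T) := i1.add i2
      have h1 := integral_mono hψ2 isum fun z => (by nlinarith [sq_nonneg (2 * h z - ψ z)] :
        ψ z ^ 2 ≤ 2 * h z ^ 2 + 2 * (h z - ψ z) ^ 2)
      rw [integral_add i1 i2, integral_const_mul, integral_const_mul] at h1
      linarith
    have hδ1 : ε ^ 2 ≤ 1 := by nlinarith
    have hεε : ε⁻¹ * ε ^ 2 = ε := by rw [pow_two, ← mul_assoc, inv_mul_cancel₀ hε.ne', one_mul]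
    -- numerical consequences
    have X1 : ε⁻¹ * (∫ z, (f z - φ z) ^ 2 ∂((pinnedChain ω₂ lam β γ).gibbsMeasure N T)) ≤ ε := by
      have := mul_le_mul_of_nonneg_left hφδ hεi.le; rwa [hεε] at this
    have X2 : ε⁻¹ * (∫ z, (h z - ψ z) ^ 2 ∂((pinnedChain ω₂ lam β γ).gibbsMeasure N T)) ≤ ε := by
      have := mul_le_mul_of_nonneg_left hψδ hεi.le; rwa [hεε] at this
    have X3 : ε⁻¹ * (∫ z, (h (z.1, -z.2) - ψ (z.1, -z.2)) ^ 2 ∂((pinnedChain ω₂ lam β γ).gibbsMeasure N T)) ≤ ε := by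
      have := mul_le_mul_of_nonneg_left d3 hεi.le; rwa [hεε] at this
    have X4 : ε⁻¹ * (∫ z, (f (z.1, -z.2) - φ (z.1, -z.2)) ^ 2 ∂((pinnedChain ω₂ lam β γ).gibbsMeasure N T)) ≤ ε := by
      have := mul_le_mul_of_nonneg_left d4 hεi.le; rwa [hεε] at this
    have Y1 : ε * (∫ z, φ z ^ 2 ∂((pinnedChain ω₂ lam β γ).gibbsMeasure N T)) ≤ ε * (2 * (∫ z, f z ^ 2 ∂((pinnedChain ω₂ lam β γ).gibbsMeasure N T)) + 2 * ε ^ 2) := mul_le_mul_of_nonneg_left hφsq hε.le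
    have Y2 : ε * (∫ z, ψ (z.1, -z.2) ^ 2 ∂((pinnedChain ω₂ lam β γ).gibbsMeasure N T)) ≤ ε * (2 * (∫ z, h z ^ 2 ∂((pinnedChain ω₂ lam β γ).gibbsMeasure N T)) + 2 * ε ^ 2) :=
      mul_le_mul_of_nonneg_left hψsq hε.le
    have Z : 0 ≤ ε * (1 - ε ^ 2) := mul_nonneg hε.le (sub_nonneg.2 hδ1)
    rw [q1] at E2
    rw [abs_le] at E1 E2 ⊢
    obtain ⟨E1a, E1b⟩ := E1
    obtain ⟨E2a, E2b⟩ := E2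
    constructor
    · linarith [X1, X2, X3, X4, Y1, Y2, Z, htest, mul_nonneg hε.le hF₂0, mul_nonneg hε.le hH₂0]
    · linarith [X1, X2, X3, X4, Y1, Y2, Z, htest, mul_nonneg hε.le hF₂0, mul_nonneg hε.le hH₂0]
  -- conclude
  have hK0 : 0 ≤ 4 + 3 * (∫ z, f z ^ 2 ∂((pinnedChain ω₂ lam β γ).gibbsMeasure N T)) + 3 * ∫ z, h z ^ 2 ∂((pinnedChain ω₂ lam β γ).gibbsMeasure N T) := by positivity
  have hd : |(∫ z, f z * (∫ y, h y ∂(((pinnedChain ω₂ lam β γ).transitionKernel N T T u) z)) ∂((pinnedChain ω₂ lam β γ).gibbsMeasure N T)) - ∫ z, h (z.1, -z.2) * (∫ y, f (y.1, -y.2) ∂(((pinnedChain ω₂ lam β γ).transitionKernel N T T u) z)) ∂((pinnedChain ω₂ lam β γ).gibbsMeasure N T)| ≤ 0 := by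
    refine le_of_forall_pos_le_add fun e he => ?_
    have hε' : 0 < min 1 (e / ((4 + 3 * (∫ z, f z ^ 2 ∂((pinnedChain ω₂ lam β γ).gibbsMeasure N T)) + 3 * ∫ z, h z ^ 2 ∂((pinnedChain ω₂ lam β γ).gibbsMeasure N T)) + 1)) :=
      lt_min one_pos (div_pos he (by positivity))
    refine (key _ hε' (min_le_left _ _)).trans ?_
    rw [zero_add]
    calc (4 + 3 * (∫ z, f z ^ 2 ∂((pinnedChain ω₂ lam β γ).gibbsMeasure N T)) + 3 * ∫ z, h z ^ 2 ∂((pinnedChain ω₂ lam β γ).gibbsMeasure N T)) *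
          min 1 (e / ((4 + 3 * (∫ z, f z ^ 2 ∂((pinnedChain ω₂ lam β γ).gibbsMeasure N T)) + 3 * ∫ z, h z ^ 2 ∂((pinnedChain ω₂ lam β γ).gibbsMeasure N T)) + 1))
        ≤ (4 + 3 * (∫ z, f z ^ 2 ∂((pinnedChain ω₂ lam β γ).gibbsMeasure N T)) + 3 * ∫ z, h z ^ 2 ∂((pinnedChain ω₂ lam β γ).gibbsMeasure N T)) *
          (e / ((4 + 3 * (∫ z, f z ^ 2 ∂((pinnedChain ω₂ lam β γ).gibbsMeasure N T)) + 3 * ∫ z, h z ^ 2 ∂((pinnedChain ω₂ lam β γ).gibbsMeasure N T)) + 1)) :=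
          mul_le_mul_of_nonneg_left (min_le_right _ _) hK0
      _ ≤ e := by
        rw [mul_div_assoc', div_le_iff₀ (by positivity)]
        nlinarith [mul_nonneg hK0 he.le]
  have h0 := abs_nonpos_iff.1 hd
  linarith

end PinnedFinal

/-- **Registered stub `stub_kernelDetailedBalance` (H2) of crux stmt-AtomisticToContinuum-9120** (line
`bath-bond-deficit-integral`): kernel-level generalised detailed balance of the equilibrium Langevin kernels of the pinned
anharmonic chain — `∫ f·(P_s h) dμ_T = ∫ (h∘Θ)·P_s(f∘Θ) dμ_T` for all measurable square-integrable `f, h`, every `s ≥ 0`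
and `N ≥ 2` (proved for `N ≥ 1`). [cite: ReyBellet2006, Lemma 4.2] -/
theorem stub_kernelDetailedBalance : ∀ ω₂ lam β γ : ℝ, 0 < ω₂ → 0 < lam → 0 < β → 0 < γ → ∀ T : ℝ, 0 < T → ∀ (N : ℕ) (hN : 1 < N), ∀ (s : NNReal) (f h : PhaseSpace N → ℝ), Measurable f → Measurable h → Integrable (fun y => f y ^ 2) ((pinnedChain ω₂ lam β γ).gibbsMeasure N T) → Integrable (fun y => h y ^ 2) ((pinnedChain ω₂ lam β γ).gibbsMeasure N T) → ∫ y, f y * (∫ y', h y' ∂((pinnedChain ω₂ lam β γ).transitionKernel N T T s) y) ∂((pinnedChain ω₂ lam β γ).gibbsMeasure N T) = ∫ y, h (y.1, -y.2) * (∫ y', f (y'.1, -y'.2) ∂((pinnedChain ω₂ lam β γ).transitionKernel N T T s) y) ∂((pinnedChain ω₂ lam β γ).gibbsMeasure N T) :=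
  fun _ _ _ _ hω hl hβ hγ _ hT _ hN s _ _ hfm hhm hf2 hh2 =>
    pinnedChain_detailedBalance hω hl hβ hγ (Nat.zero_lt_of_lt hN) hT hfm hhm hf2 hh2 s

end Summit.AtomisticToContinuum.FouriersLaw.Theorems.SubdiffusiveBondHeat
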